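import Summits.Schanuel.Schanuel.Theorems.KhovanskiiApproxType.Negative.LoadBearing
import Summits.Schanuel.Schanuel.Theorems.DiophantineDichotomyKhovanskiiApproxTypeEvDefs
import Summits.Schanuel.Schanuel.Theorems.EPiSimultaneousType.Negative.CoordinatewiseLinear

/-!
# Negative lemma for crux `KhovanskiiApproxTypeEv` (stmt-Schanuel-14972): the exponent floor
# `a ≥ 1/2` at `n = 2`, kernel-checked at the free Khovanskii point `s = (1 + i, 1 − i)`

Route `DiophantineDichotomy`, crux `KhovanskiiApproxTypeEv` (eventual simultaneous approximation type
`a < 1/(n−1)` at every free Khovanskii point of `ℂⁿ`, `n ≥ 2`).  The route text records the floor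
`a ≥ 1/n` ("expected truth `a = 1/n`; `a < 1/n` is refuted by AP(n) at `θ`") as PRINTED BUT NOT
FORMALISED, pending Philippon's approximation property in `ℙ²`.  This file kernel-checks the floor at
`n = 2` WITHOUT the approximation property, at one explicit Lindemann–Weierstrass point, by a
complex-conjugation trick:

* at `s = (1 + i, 1 − i)` (algebraic, `ℚ`-linearly independent, a non-degenerate zero of the
  Khovanskii system `z₁ + z₂ − 2 = 0`, `z₁ z₂ − 2 = 0`) the point is
  `θ = (1 + i, 1 − i, ξ, ξ̄)` with `ξ = e^{1+i}` (`e^{1−i} = conj e^{1+i}`);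
* Diaz's theorem (Bugeaud 2004 Thm 8.11, PROVED in tree) gives `α` of degree `≤ n`, `M(α) ≤ M`, with
  `|ξ − α| ≤ exp(−0.006(n log M(α) + deg α · log M))`; its complex conjugate `ᾱ` is a root of the
  SAME integer polynomial, hence has the SAME height, and `|ξ̄ − ᾱ| = |ξ − α|`;
* so the challenger `γ = (1 + i, 1 − i, α, ᾱ) ∈ ℚ(i, α, ᾱ)` is admissible at level
  `(d, H) = (2n², max(H₀, 2, H(α)))` — common field of degree `≤ 2·n·n`, heights `≤ H` — at distance
  `|ξ − α|` from `θ`, whose quality `0.006 n · log M(α)` is LINEAR in `n = (d/2)^{1/2}`;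
* hence `exp(−C(dᵃ log H + dᵇ)) ≤ ‖γ − θ‖` fails past every threshold `H₀(d)` as soon as
  `C (2n²)ᵃ ≤ 0.003 n`, i.e. for every `a < 1/2` (`not_approxTypeEvAt_conjPair`).

Consequences (sorry-free): `khovanskiiApproxTypeEv_false_sharp` — the crux with the generic
exponent EXCLUDED (`a < 1/n` for `a < 1/(n−1)`) is false (witness `n = 2`); the same for the all-heights
crux 6116 (`khovanskiiApproxType_false_sharp`); the line's LW layer `EvLWTwo` (`a < 1`, value `3/4`
via Ably 1994 + transfer spine) cannot pass below `1/2` (`evLWTwo_exponent_ge_half`, `evLWTwo_window`).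
The trick needs the two transcendental slots of `θ` to be complex conjugates (only `n = 2`:
`s = (σ, σ̄)`, `σ ∉ ℝ ∪ iℝ`); for `n ≥ 3` the floor `a ≥ 1/n` still awaits AP(n).  Vocabulary:
`ApproxTypeEvAt`, `khovanskiiApproxTypeEv_iff`, `EvLWTwo` (line lead's EvDefs module); `natHeight`,
`exists_deg` (6116 `Negative/LoadBearing.lean`); `finrank_adjoin_simple_le_of_clause`
(`EPiSimultaneousType/Negative/CoordinatewiseLinear.lean`).
-/

noncomputable section

set_option linter.dupNamespace false

namespace Summit.Schanuel.Schanuel.Cruxes.KhovanskiiApproxTypeEv.Negative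

open Summit.Schanuel.Schanuel.Theses.DiophantineDichotomy (KhovanskiiApproxTypeEv KhovanskiiApproxType)
open Summit.Schanuel.Schanuel.Cruxes.KhovanskiiApproxType.LwSmallHeight
open Summit.Schanuel.Schanuel.Cruxes.KhovanskiiApproxType.Negative
open Summit.Schanuel.Schanuel.Cruxes.KhovanskiiApproxTypeEv.AnchoredReduction
  (ApproxTypeEvAt khovanskiiApproxTypeEv_iff EvLWTwo)
open Summit.Schanuel.Schanuel.Theorems.EPiSimultaneousType (finrank_adjoin_simple_le_of_clause)
open Polynomial Complex
open scoped IntermediateField ComplexConjugate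
open Literature.NumberTheory.DiophantineApproximation (Bugeaud2004_thm_8_11_holds
  one_le_mahlerMeasure_map)

/-! ## The point `s = (1 + i, 1 − i)` -/

/-- `(1 + i, 1 − i)` is `ℚ`-linearly independent. -/
theorem linearIndependent_conjPair : LinearIndependent ℚ ![(1 : ℂ) + I, 1 - I] := by
  rw [LinearIndependent.pair_iff]
  intro s t hst
  rw [Rat.smul_def, Rat.smul_def] at hst
  have hre := congrArg Complex.re hst
  have him := congrArg Complex.im hst
  simp at hre him
  have hs : (s : ℝ) = 0 := by linarith
  have ht : (t : ℝ) = 0 := by linarith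
  exact ⟨by exact_mod_cast hs, by exact_mod_cast ht⟩

/-- `(1 + i, 1 − i)` is a non-degenerate zero of the Khovanskii system `z₁ + z₂ − 2 = 0`,
`z₁ z₂ − 2 = 0` over `ℚ`: the exponential Jacobian is `[[1, 1], [z₂, z₁]]`, determinant
`z₁ − z₂ = 2i ≠ 0`. (Every `ℚ̄`-point is free Khovanskii; this is the explicit instance used.) -/
theorem isFreeKhovanskii_conjPair : IsFreeKhovanskii 2 ![(1 : ℂ) + I, 1 - I] := by
  classical
  refine ⟨![MvPolynomial.X (Sum.inl 0) + MvPolynomial.X (Sum.inl 1) - MvPolynomial.C 2,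
    MvPolynomial.X (Sum.inl 0) * MvPolynomial.X (Sum.inl 1) - MvPolynomial.C 2], ?_, ?_⟩
  · intro i
    fin_cases i
    · simp; ring
    · simp
      ring_nf
      simp
  · rw [Matrix.det_fin_two]
    simp [Matrix.of_apply, MvPolynomial.pderiv_X, Derivation.leibniz]

/-- `e^{1−i}` is the complex conjugate of `e^{1+i}`. -/
theorem exp_one_sub_I : Complex.exp (1 - I) = conj (Complex.exp (1 + I)) := by
  rw [← Complex.exp_conj]
  congr 1
  simp [map_add, Complex.conj_I, sub_eq_add_neg]

/-- Evaluation of the integer polynomial `X² − 2X + 2` (minimal polynomial of `1 ± i`). -/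
theorem aeval_quad (z : ℂ) :
    Polynomial.aeval z (X ^ 2 - Polynomial.C 2 * X + Polynomial.C 2 : Polynomial ℤ) =
      z ^ 2 - 2 * z + 2 := by
  simp only [map_add, map_sub, map_mul, map_pow, Polynomial.aeval_X, map_ofNat]

/-- The coefficients of `X² − 2X + 2` are bounded by `2` in absolute value. -/
theorem abs_coeff_quad_le (k : ℕ) :
    |(X ^ 2 - Polynomial.C 2 * X + Polynomial.C 2 : Polynomial ℤ).coeff k| ≤ 2 := by
  rcases k with _ | _ | _ | k
  · norm_num [coeff_X, coeff_C, coeff_X_pow]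
  · norm_num [coeff_X, coeff_C, coeff_X_pow]
  · norm_num [coeff_X, coeff_C, coeff_X_pow]
  · have hk : k + 1 + 1 + 1 ≠ 2 := by omega
    simp [coeff_X, coeff_X_pow, hk]

/-- The coefficients of `X² + 1` are bounded by `1` in absolute value. -/
theorem abs_coeff_Xsq_add_one_le (k : ℕ) :
    |(X ^ 2 + 1 : Polynomial ℤ).coeff k| ≤ 1 := by
  rcases k with _ | _ | _ | k
  · simp [coeff_one, coeff_X_pow]
  · simp [coeff_one, coeff_X_pow]
  · simp [coeff_one, coeff_X_pow]
  · have hk : k + 1 + 1 + 1 ≠ 2 := by omega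
    simp [coeff_one, coeff_X_pow, hk]

/-! ## The engine: a conjugate pair of Diaz challengers beats every `a < 1/2` -/

set_option maxHeartbeats 1600000 in
/-- **At `θ = (1+i, 1−i, e^{1+i}, e^{1−i})` there is no eventual approximation type with `a < 1/2`.**
The challengers are `(1+i, 1−i, α, ᾱ)` with `α` the Diaz approximation of `e^{1+i}` of degree `≤ n`
(Bugeaud 2004 Thm 8.11, PROVED in tree), budget `d = 2n²` (common field `ℚ(i, α, ᾱ)`), height
`H = max(H₀(d), 2, H(minpoly α))`; `ᾱ` is a root of the same integer polynomial and
`|e^{1−i} − ᾱ| = |e^{1+i} − α|`, so the quality `0.006(n log M(α) + deg α · log M)`, linear in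
`n ≍ d^{1/2}`, beats `exp(−C(dᵃ log H + dᵇ))` once `C(2n²)ᵃ ≤ 0.003 n` and `log M` is large.
[cite: Bugeaud2004, Thm 8.11] -/
theorem not_approxTypeEvAt_conjPair (a b C : ℝ) (ha : a < 1 / 2) :
    ¬ ApproxTypeEvAt 2 ![(1 : ℂ) + I, 1 - I] a b C := by
  rintro ⟨hC, hall⟩
  -- nonnegative exponents dominate
  set a' : ℝ := max a 0 with ha'
  set b' : ℝ := max b 0 with hb'
  have ha'h : a' < 1 / 2 := max_lt ha (by norm_num)
  have h2a' : 2 * a' < 1 := by linarith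
  obtain ⟨n, hn50, hn⟩ := exists_deg (2 * a') (2 * C) h2a' (by linarith)
  have hn1nat : 1 ≤ n := le_trans (by norm_num) hn50
  have hn1 : (1 : ℝ) ≤ n := by exact_mod_cast hn1nat
  have hnpos : (0 : ℝ) < n := by linarith
  -- the budget d = 2 n² and the bound C d^{a'} ≤ 0.003 n
  set d : ℕ := 2 * n ^ 2 with hddef
  have hdcast : (d : ℝ) = 2 * (n : ℝ) ^ 2 := by rw [hddef]; push_cast; ring
  have hnd : n ≤ d := by rw [hddef]; nlinarith
  have h2d : 2 ≤ d := by rw [hddef]; nlinarith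
  have hd1 : (1 : ℝ) ≤ d := by exact_mod_cast (hn1nat.trans hnd)
  have hda' : C * (d : ℝ) ^ a' ≤ 3 / 1000 * n := by
    have h1 : (d : ℝ) ^ a' = (2 : ℝ) ^ a' * (n : ℝ) ^ (2 * a') := by
      rw [hdcast, Real.mul_rpow (by norm_num) (by positivity)]
      congr 1
      rw [show ((n : ℝ) ^ 2) = (n : ℝ) ^ (2 : ℝ) by norm_cast, ← Real.rpow_mul hnpos.le]
    have h2 : (2 : ℝ) ^ a' ≤ 2 := by
      have := Real.rpow_le_rpow_of_exponent_le (by norm_num : (1 : ℝ) ≤ 2) (by linarith : a' ≤ 1)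
      rwa [Real.rpow_one] at this
    have h3 : 0 ≤ (n : ℝ) ^ (2 * a') := by positivity
    calc C * (d : ℝ) ^ a' = C * ((2 : ℝ) ^ a' * (n : ℝ) ^ (2 * a')) := by rw [h1]
      _ ≤ C * (2 * (n : ℝ) ^ (2 * a')) := by gcongr
      _ = 2 * C * (n : ℝ) ^ (2 * a') := by ring
      _ ≤ 3 / 1000 * n := hn
  -- the threshold of the eventual form at budget d
  obtain ⟨H₀, hH₀⟩ := hall d
  set H₁ : ℕ := max H₀ 2 with hH₁def
  have hH₁2nat : 2 ≤ H₁ := le_max_right _ _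
  have hH₁1 : (1 : ℝ) ≤ H₁ := by exact_mod_cast le_trans (by norm_num) hH₁2nat
  have hH₁pos : (0 : ℝ) < H₁ := by linarith
  have hlogH₁ : 0 ≤ Real.log H₁ := Real.log_nonneg hH₁1
  -- the M-independent slack (threshold included) and the choice of M
  set K0 : ℝ := C * ((d : ℝ) ^ a' * (n * Real.log 2 + Real.log H₁) + (d : ℝ) ^ b') with hK0
  set ξ : ℂ := Complex.exp (1 + I) with hξ
  set M : ℝ := max (max ((n : ℝ) + 1) ((4 + ‖ξ‖) ^ 100)) (Real.exp (K0 / (6 / 1000) + 1))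
    with hMdef
  have hM1 : (n : ℝ) + 1 ≤ M := (le_max_left _ _).trans (le_max_left _ _)
  have hM2 : (4 + ‖ξ‖) ^ 100 ≤ M := (le_max_right _ _).trans (le_max_left _ _)
  have hMpos : 0 < M := by linarith
  have hlogM : K0 / (6 / 1000) + 1 ≤ Real.log M := by
    rw [Real.le_log_iff_exp_le hMpos]
    exact le_max_right _ _
  -- Diaz / Bugeaud 8.11 at ξ = e^{1+i}
  obtain ⟨α, P, hPirr, hPα, hPdeg, hPM, hdist⟩ := Bugeaud2004_thm_8_11_holds ξ n M hn50 hM1 hM2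
  have hP0 : P ≠ 0 := hPirr.ne_zero
  have hdP : 1 ≤ P.natDegree := by
    rw [Nat.one_le_iff_ne_zero]
    intro h0
    have hc : P = Polynomial.C (P.coeff 0) := eq_C_of_natDegree_eq_zero h0
    rw [hc, aeval_C, algebraMap_int_eq, eq_intCast, Int.cast_eq_zero] at hPα
    exact hP0 (by rw [hc, hPα, map_zero])
  set MP : ℝ := (P.map (Int.castRingHom ℂ)).mahlerMeasure with hMP
  have hMP1 : 1 ≤ MP := one_le_mahlerMeasure_map P hP0
  have hlogMP : 0 ≤ Real.log MP := Real.log_nonneg hMP1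
  -- the conjugate root
  have hPα' : Polynomial.aeval (conj α) P = 0 := by
    have h := Polynomial.aeval_algHom_apply ((starRingEnd ℂ).toIntAlgHom) α P
    rw [RingHom.toIntAlgHom_apply] at h
    change Polynomial.aeval (conj α) P = conj (Polynomial.aeval α P) at h
    rw [h, hPα, map_zero]
  -- the challenger γ = (1+i, 1−i, α, conj α), budget d, height H := max H₁ (natHeight P) ≥ H₀
  set H : ℕ := max H₁ (natHeight P) with hHdef
  have hHP : natHeight P ≤ H := le_max_right _ _
  have hH0le : H₀ ≤ H := (le_max_left H₀ 2).trans (le_max_left _ _)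
  have hH2 : 2 ≤ H := hH₁2nat.trans (le_max_left _ _)
  have hH1r : (1 : ℝ) ≤ H := by exact_mod_cast le_trans (by norm_num) hH2
  have hHpos : (0 : ℝ) < H := by linarith
  set γ : Fin 2 ⊕ Fin 2 → ℂ := Sum.elim ![(1 : ℂ) + I, 1 - I] ![α, conj α] with hγ
  -- coordinatewise clauses at level (d, H)
  have hquad : ∀ z : ℂ, z = 1 + I ∨ z = 1 - I → ∃ Q : Polynomial ℤ, Q ≠ 0 ∧ Q.natDegree ≤ d ∧
      (∀ k, |Q.coeff k| ≤ (H : ℤ)) ∧ Polynomial.aeval z Q = 0 := by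
    intro z hz
    have hQ0 : (X ^ 2 - Polynomial.C 2 * X + Polynomial.C 2 : Polynomial ℤ) ≠ 0 := by
      intro h
      have := congrArg (fun Q : Polynomial ℤ => Q.coeff 0) h
      simp at this
    refine ⟨X ^ 2 - Polynomial.C 2 * X + Polynomial.C 2, hQ0, ?_, ?_, ?_⟩
    · have : (X ^ 2 - Polynomial.C 2 * X + Polynomial.C 2 : Polynomial ℤ).natDegree ≤ 2 := by
        compute_degree!
      exact this.trans h2d
    · intro k
      have hH2z : (2 : ℤ) ≤ H := by exact_mod_cast hH2
      exact (abs_coeff_quad_le k).trans hH2z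
    · have hI : I ^ 2 = -1 := Complex.I_sq
      rcases hz with rfl | rfl
      · rw [aeval_quad]; linear_combination hI
      · rw [aeval_quad]; linear_combination hI
  have hclα : ∀ z : ℂ, z = α ∨ z = conj α → ∃ Q : Polynomial ℤ, Q ≠ 0 ∧ Q.natDegree ≤ n ∧
      (∀ k, |Q.coeff k| ≤ (H : ℤ)) ∧ Polynomial.aeval z Q = 0 := by
    intro z hz
    refine ⟨P, hP0, hPdeg, fun k => (abs_coeff_le_natHeight P k).trans (by exact_mod_cast hHP), ?_⟩
    rcases hz with rfl | rfl
    · exact hPα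
    · exact hPα'
  have hcl : ∀ i, ∃ Q : Polynomial ℤ, Q ≠ 0 ∧ Q.natDegree ≤ d ∧ (∀ k, |Q.coeff k| ≤ (H : ℤ)) ∧
      Polynomial.aeval (γ i) Q = 0 := by
    rintro (i | i) <;> fin_cases i
    · exact hquad _ (Or.inl (by simp [hγ]))
    · exact hquad _ (Or.inr (by simp [hγ]))
    · obtain ⟨Q, h1, h2, h3, h4⟩ := hclα α (Or.inl rfl)
      exact ⟨Q, h1, h2.trans hnd, h3, by simpa [hγ] using h4⟩
    · obtain ⟨Q, h1, h2, h3, h4⟩ := hclα (conj α) (Or.inr rfl)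
      exact ⟨Q, h1, h2.trans hnd, h3, by simpa [hγ] using h4⟩
  -- the common field ℚ(i, α, conj α) has degree ≤ 2 n²
  have hfr : Module.finrank ℚ ↥(IntermediateField.adjoin ℚ (Set.range γ)) ≤ d := by
    have hIcl : ∃ Q : Polynomial ℤ, Q ≠ 0 ∧ Q.natDegree ≤ 2 ∧ (∀ k, |Q.coeff k| ≤ ((1 : ℕ) : ℤ)) ∧
        Polynomial.aeval I Q = 0 := by
      refine ⟨X ^ 2 + 1, ?_, by compute_degree!, ?_, by simp⟩
      · intro h
        have := congrArg (fun Q : Polynomial ℤ => Q.coeff 0) h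
        simp at this
      · intro k
        exact_mod_cast abs_coeff_Xsq_add_one_le k
    obtain ⟨hiI, hI⟩ := finrank_adjoin_simple_le_of_clause hIcl
    obtain ⟨hiα, hα⟩ := finrank_adjoin_simple_le_of_clause (hclα α (Or.inl rfl))
    obtain ⟨hiα', hα'⟩ := finrank_adjoin_simple_le_of_clause (hclα (conj α) (Or.inr rfl))
    haveI : FiniteDimensional ℚ ↥ℚ⟮I⟯ := IntermediateField.adjoin.finiteDimensional hiI
    haveI : FiniteDimensional ℚ ↥ℚ⟮α⟯ := IntermediateField.adjoin.finiteDimensional hiα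
    haveI : FiniteDimensional ℚ ↥ℚ⟮conj α⟯ := IntermediateField.adjoin.finiteDimensional hiα'
    set F : IntermediateField ℚ ℂ := ℚ⟮I⟯ ⊔ (ℚ⟮α⟯ ⊔ ℚ⟮conj α⟯) with hF
    have hIF : I ∈ F := (le_sup_left : ℚ⟮I⟯ ≤ F) (IntermediateField.mem_adjoin_simple_self ℚ _)
    have hαF : α ∈ F :=
      (le_sup_left.trans (le_sup_right : ℚ⟮α⟯ ⊔ ℚ⟮conj α⟯ ≤ F)) (IntermediateField.mem_adjoin_simple_self ℚ _)
    have hα'F : conj α ∈ F :=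
      (le_sup_right.trans (le_sup_right : ℚ⟮α⟯ ⊔ ℚ⟮conj α⟯ ≤ F)) (IntermediateField.mem_adjoin_simple_self ℚ _)
    have hle : IntermediateField.adjoin ℚ (Set.range γ) ≤ F := by
      rw [IntermediateField.adjoin_le_iff]
      rintro _ ⟨i, rfl⟩
      rcases i with i | i <;> fin_cases i
      · show (1 : ℂ) + I ∈ F
        exact add_mem (one_mem _) hIF
      · show (1 : ℂ) - I ∈ F
        exact sub_mem (one_mem _) hIF
      · exact hαF
      · exact hα'F
    calc Module.finrank ℚ ↥(IntermediateField.adjoin ℚ (Set.range γ))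
        ≤ Module.finrank ℚ ↥F := IntermediateField.finrank_le_of_le_right hle
      _ ≤ Module.finrank ℚ ↥ℚ⟮I⟯ * Module.finrank ℚ ↥(ℚ⟮α⟯ ⊔ ℚ⟮conj α⟯) :=
          IntermediateField.finrank_sup_le _ _
      _ ≤ Module.finrank ℚ ↥ℚ⟮I⟯ * (Module.finrank ℚ ↥ℚ⟮α⟯ * Module.finrank ℚ ↥ℚ⟮conj α⟯) :=
          Nat.mul_le_mul_left _ (IntermediateField.finrank_sup_le _ _)
      _ ≤ 2 * (n * n) := Nat.mul_le_mul hI (Nat.mul_le_mul hα hα')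
      _ = d := by rw [hddef]; ring
  have key := hH₀ H γ hH0le hfr hcl
  -- the distance is |ξ - α| in both transcendental slots
  have hdist' : ‖γ - Sum.elim ![(1 : ℂ) + I, 1 - I] (Complex.exp ∘ ![(1 : ℂ) + I, 1 - I])‖ ≤
      ‖ξ - α‖ := by
    refine (pi_norm_le_iff_of_nonneg (norm_nonneg _)).mpr ?_
    rintro (i | i) <;> revert i <;> refine Fin.forall_fin_two.mpr ⟨?_, ?_⟩
    · simp [hγ]
    · simp [hγ]
    · simp [hγ, hξ, norm_sub_rev]
    · calc ‖(γ - Sum.elim ![(1 : ℂ) + I, 1 - I] (Complex.exp ∘ ![(1 : ℂ) + I, 1 - I])) (Sum.inr 1)‖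
          = ‖conj α - conj ξ‖ := by simp [hγ, hξ, exp_one_sub_I]
        _ ≤ ‖ξ - α‖ := le_of_eq (by rw [← map_sub, Complex.norm_conj, norm_sub_rev])
  -- height bookkeeping: log H ≤ log H₁ + n log 2 + log M(P)
  have hlogH : Real.log H ≤ Real.log H₁ + n * Real.log 2 + Real.log MP := by
    have h2n1 : (1 : ℝ) ≤ 2 ^ n * MP := one_le_mul_of_one_le_of_one_le (one_le_pow₀ (by norm_num)) hMP1
    have hHle : (H : ℝ) ≤ (H₁ : ℝ) * (2 ^ n * MP) := by
      have hcast : (H : ℝ) = max (H₁ : ℝ) (natHeight P : ℝ) := by rw [hHdef]; push_cast; rfl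
      rw [hcast]
      refine max_le (le_mul_of_one_le_right hH₁pos.le h2n1) ?_
      calc (natHeight P : ℝ) ≤ 2 ^ P.natDegree * MP := natHeight_le P
        _ ≤ 2 ^ n * MP := by gcongr; norm_num
        _ ≤ (H₁ : ℝ) * (2 ^ n * MP) := le_mul_of_one_le_left (by positivity) hH₁1
    calc Real.log H ≤ Real.log ((H₁ : ℝ) * (2 ^ n * MP)) := Real.log_le_log hHpos hHle
      _ = Real.log H₁ + n * Real.log 2 + Real.log MP := by
        rw [Real.log_mul hH₁pos.ne' (by positivity), Real.log_mul (by positivity) (by positivity),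
          Real.log_pow]
        ring
  -- exponent bookkeeping
  have hna : (d : ℝ) ^ a ≤ (d : ℝ) ^ a' := Real.rpow_le_rpow_of_exponent_le hd1 (le_max_left _ _)
  have hnb : (d : ℝ) ^ b ≤ (d : ℝ) ^ b' := Real.rpow_le_rpow_of_exponent_le hd1 (le_max_left _ _)
  have hlogH0 : 0 ≤ Real.log H := Real.log_nonneg hH1r
  have hda'0 : 0 ≤ (d : ℝ) ^ a' := by positivity
  have hLHS : C * ((d : ℝ) ^ a * Real.log H + (d : ℝ) ^ b) ≤
      3 / 1000 * ((n : ℝ) * Real.log MP) + K0 := by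
    have step : C * (d : ℝ) ^ a' * Real.log MP ≤ 3 / 1000 * n * Real.log MP :=
      mul_le_mul_of_nonneg_right hda' hlogMP
    calc C * ((d : ℝ) ^ a * Real.log H + (d : ℝ) ^ b)
        ≤ C * ((d : ℝ) ^ a' * Real.log H + (d : ℝ) ^ b') := by gcongr
      _ ≤ C * ((d : ℝ) ^ a' * (Real.log H₁ + n * Real.log 2 + Real.log MP) + (d : ℝ) ^ b') := by
          gcongr
      _ = C * (d : ℝ) ^ a' * Real.log MP + K0 := by rw [hK0]; ring
      _ ≤ 3 / 1000 * n * Real.log MP + K0 := by linarith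
      _ = 3 / 1000 * ((n : ℝ) * Real.log MP) + K0 := by ring
  have hKM : K0 < 6 / 1000 * Real.log M := by
    have h6 : (6 / 1000 : ℝ) * (K0 / (6 / 1000)) = K0 := by field_simp
    have h := mul_le_mul_of_nonneg_left hlogM (by norm_num : (0 : ℝ) ≤ 6 / 1000)
    rw [mul_add, h6] at h
    linarith
  have hX0 : 0 ≤ (n : ℝ) * Real.log MP := by positivity
  have hlM : 0 ≤ Real.log M := by
    have hK0nn : 0 ≤ K0 := by rw [hK0]; positivity
    linarith
  have hY : Real.log M ≤ (P.natDegree : ℝ) * Real.log M :=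
    le_mul_of_one_le_left hlM (by exact_mod_cast hdP)
  have hgap : C * ((d : ℝ) ^ a * Real.log H + (d : ℝ) ^ b) <
      6 / 1000 * ((n : ℝ) * Real.log MP + (P.natDegree : ℝ) * Real.log M) := by
    linarith
  -- contradiction
  have hchain : Real.exp (-(C * ((d : ℝ) ^ a * Real.log H + (d : ℝ) ^ b))) ≤
      Real.exp (-(6 / 1000 * ((n : ℝ) * Real.log MP + (P.natDegree : ℝ) * Real.log M))) :=
    key.trans (hdist'.trans hdist)
  rw [Real.exp_le_exp] at hchain
  linarith

/-! ## Consequences: the sharp strengthening is false; the LW window cannot pass below `1/2` -/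

/-- The crux with the GENERIC exponent excluded: `a < 1/n` in place of `a < 1/(n−1)` (the route's
"expected truth `a = 1/n`" says this should fail; here it is kernel-checked at `n = 2`). -/
def KhovanskiiApproxTypeEvSharp : Prop :=
  ∀ (n : ℕ) (s : Fin n → ℂ), 2 ≤ n → LinearIndependent ℚ s →
    IsFreeKhovanskii n s → ∃ a b C : ℝ, a < 1 / (n : ℝ) ∧ ApproxTypeEvAt n s a b C

/-- The all-heights crux 6116 with the generic exponent excluded (`a < 1/n`). -/
def KhovanskiiApproxTypeSharp : Prop :=
  ∀ (n : ℕ) (s : Fin n → ℂ), 2 ≤ n → LinearIndependent ℚ s →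
    IsFreeKhovanskii n s → ∃ a b C : ℝ, a < 1 / (n : ℝ) ∧ ApproxTypeAt n s a b C

/-- **The eventual crux cannot be sharpened to `a < 1/n`:** at `n = 2`, `s = (1 + i, 1 − i)` no
eventual approximation type has `a < 1/2`. [folklore] -/
theorem khovanskiiApproxTypeEv_false_sharp : ¬ KhovanskiiApproxTypeEvSharp := by
  intro h
  obtain ⟨a, b, C, ha, hAT⟩ := h 2 _ le_rfl linearIndependent_conjPair isFreeKhovanskii_conjPair
  have ha' : a < 1 / 2 := by norm_num at ha ⊢; linarith
  exact not_approxTypeEvAt_conjPair a b C ha' hAT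

/-- **Nor can the all-heights crux 6116** (it implies its eventual form pointwise). [folklore] -/
theorem khovanskiiApproxType_false_sharp : ¬ KhovanskiiApproxTypeSharp := by
  intro h
  obtain ⟨a, b, C, ha, hC, hAT⟩ := h 2 _ le_rfl linearIndependent_conjPair isFreeKhovanskii_conjPair
  have ha' : a < 1 / 2 := by norm_num at ha ⊢; linarith
  exact not_approxTypeEvAt_conjPair a b C ha'
    ⟨hC, fun d => ⟨0, fun H γ _ hdeg hroot => hAT d H γ hdeg hroot⟩⟩

/-- **The window of the Lindemann–Weierstrass layer is `[1/2, 1)`:** whatever exponent `EvLWTwo`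
is proved with (the line's value is `3/4`), at the LW point `(1 + i, 1 − i)` every admissible
exponent is `≥ 1/2`. [folklore] -/
theorem evLWTwo_exponent_ge_half (a b C : ℝ) (h : ApproxTypeEvAt 2 ![(1 : ℂ) + I, 1 - I] a b C) :
    1 / 2 ≤ a := by
  by_contra hlt
  exact not_approxTypeEvAt_conjPair a b C (not_le.mp hlt) h

/-- The LW point `(1 + i, 1 − i)` is in the scope of `EvLWTwo` (both coordinates algebraic), so the
layer statement itself pins its exponent there into `[1/2, 1)`. [folklore] -/
theorem evLWTwo_window (hLW : EvLWTwo) :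
    ∃ a b C : ℝ, 1 / 2 ≤ a ∧ a < 1 ∧ ApproxTypeEvAt 2 ![(1 : ℂ) + I, 1 - I] a b C := by
  have halg : ∀ i, IsAlgebraic ℚ (![(1 : ℂ) + I, 1 - I] i) := by
    have hI : IsAlgebraic ℚ I := ⟨X ^ 2 + 1, by
      intro h; have := congrArg (fun Q : Polynomial ℚ => Q.coeff 0) h; simp at this, by simp⟩
    have h1 : IsAlgebraic ℚ (1 : ℂ) := isAlgebraic_one
    intro i
    fin_cases i
    · exact h1.add hI
    · exact h1.sub hI
  obtain ⟨a, b, C, ha, hAT⟩ := hLW _ halg linearIndependent_conjPair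
  exact ⟨a, b, C, evLWTwo_exponent_ge_half a b C hAT, ha, hAT⟩

end Summit.Schanuel.Schanuel.Cruxes.KhovanskiiApproxTypeEv.Negative

end
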